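import Mathlib.Algebra.MvPolynomial.CommRing
import Mathlib.Algebra.Polynomial.Basic
import Mathlib.Analysis.Complex.Basic
import Mathlib.Data.Matrix.Basic
import Mathlib.LinearAlgebra.Matrix.Notation
import Mathlib.Tactic
import Literature.Computability.AlgebraicComplexity.GateQuotients
import Literature.Computability.AlgebraicComplexity.QuasiPolynomialFormulasProofs
import Literature.Computability.AlgebraicComplexity.BorderQWordClosure
import HarnessLib

/-!
# Integral border Q-words, II: straight-line programs (BIZ18 Thm 3.1 at quasi-polynomial scale)

Bringmann–Ikenmeyer–Zuiddam's Theorem 3.1 (`VF ⊆ closure(VP₂)`, J. ACM 65 (2018) art. 32, §3)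
from CIRCUITS and at QUASI-POLYNOMIAL scale: the gadget calculus of `BorderQWordClosure.lean`
(hypotheses `ADD[σ]`, `SMUL[σ]`, `CUBE[σ]`, `SQ[σ]`, notation as there) is run along the tree's
VSBR/Hyafil stage recursion (`GateQuotients.lean`: `HomCircuit.expandAtom` — an atom of formal
degree `≥ 2` is a sum of `≤ #ι²` products of `≤ 5` atoms of at most half the formal degree — and
`SLP.homogenize`), exactly as `QuasiPolynomialFormulasProofs.exists_formula_aval/_val` do for
formula size (BCS 1997, Thm. (21.36)), instead of Brent-balanced formulas (BIZ18 Prop. 3.6):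

* `BorderQWord.ibq_aval` — an atom of formal degree `≤ 2^j`: shift `≤ 3 K^j`, length
  `≤ K^j (8 #σ + 29)` at precision `3`, `K = 2^25 #ι²`;
* `BorderQWord.ibq_val` — a line value of total degree `≤ d` of an SLP (sum of `d + 1`
  homogeneous components, nodes of `homogenize d` on `≤ 4 len (d+1)²` nodes);
* `BorderQWord.stage_shift_bound`, `stage_length_bound` — the arithmetic `… ≤ 2^(100 E²)`;
* `BorderQWord.exists_ibq_val_qp` — the packaged statement (verbatim the stub `stub_stage` of
  the crux skeleton `Summits/ValiantsHypothesis/ValiantsHypothesis/Cruxes/WordLengthQP/Lines/Sketch.lean`):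
  GIVEN the gadgets, every line value of degree `≤ d < 2^E` of an SLP of length `≤ 2^E` over
  `≤ 2^E` variables has an integral border Q-word of shift and length `≤ 2^(100 E²)`, precision `1`.

References: [BringmannIkenmeyerZuiddam2018] §3 (Thm 3.1, Prop. 3.5–3.6);
[BurgisserClausenShokrollahi1997] Thm. (21.36), proof (F)–(H); [Tavenas2015] (the `×`-balanced
expansion of `GateQuotients.lean`).
-/

noncomputable section

open MvPolynomial

namespace Literature.Computability.AlgebraicComplexity

namespace BorderQWord

open DepthReduction

/-- `IBQ[σ | f, μ, κ, L]` (local notation, not a definition): `f` has an integral border Q-word of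
shift `≤ μ`, precision `κ`, length `≤ L` — spelled out exactly as in the skeleton of the line. -/
local notation3 (prettyPrint := false) "IBQ[" σ " | " f ", " μ ", " κ ", " L "]" =>
  ∃ w : List ((Polynomial ℂ × Option σ) × ℕ), w.length ≤ L ∧ ∃ M : ℕ, M ≤ μ ∧
    ∃ G : Matrix (Fin 2) (Fin 2) (MvPolynomial σ (Polynomial ℂ)),
      (w.map (fun l => (!![MvPolynomial.C l.1.1 * l.1.2.elim 1 MvPolynomial.X,
          MvPolynomial.C (Polynomial.X ^ l.2); MvPolynomial.C (Polynomial.X ^ l.2), 0] :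
            Matrix (Fin 2) (Fin 2) (MvPolynomial σ (Polynomial ℂ))))).prod
        = (MvPolynomial.C (Polynomial.X ^ M) : MvPolynomial σ (Polynomial ℂ)) •
            (!![MvPolynomial.map Polynomial.C f, 1; 1, 0] :
              Matrix (Fin 2) (Fin 2) (MvPolynomial σ (Polynomial ℂ)))
          + (MvPolynomial.C (Polynomial.X ^ (M + κ)) : MvPolynomial σ (Polynomial ℂ)) • G

/-- `ADD[σ]` (local notation): the addition gadget at the variable type `σ` (BIZ18 Lemma 3.2). -/
local notation3 (prettyPrint := false) "ADD[" σ "]" =>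
  ∀ (f g : MvPolynomial σ ℂ) (μ₁ μ₂ κ L₁ L₂ : ℕ),
    IBQ[σ | f, μ₁, κ, L₁] → IBQ[σ | g, μ₂, κ, L₂] → IBQ[σ | f + g, μ₁ + μ₂, κ, L₁ + L₂ + 1]

/-- `SMUL[σ]` (local notation): the free-scalar gadget at the variable type `σ`. -/
local notation3 (prettyPrint := false) "SMUL[" σ "]" =>
  ∀ (γ : ℂ) (f : MvPolynomial σ ℂ) (μ κ L : ℕ), IBQ[σ | f, μ, κ, L] → IBQ[σ | γ • f, μ, κ, L + 6]

/-- `CUBE[σ]` (local notation): the substitution `ε ↦ ε³` at the variable type `σ`. -/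
local notation3 (prettyPrint := false) "CUBE[" σ "]" =>
  ∀ (f : MvPolynomial σ ℂ) (μ κ L : ℕ), IBQ[σ | f, μ, κ, L] → IBQ[σ | f, 3 * μ, 3 * κ, L]

/-- `SQ[σ]` (local notation): the squaring gadget at the variable type `σ` (BIZ18 Lemma 3.3). -/
local notation3 (prettyPrint := false) "SQ[" σ "]" =>
  ∀ (f : MvPolynomial σ ℂ) (μ L : ℕ), IBQ[σ | f, μ, 3, L] → IBQ[σ | f ^ 2, 2 * μ + 4, 1, 2 * L + 11]

variable {σ : Type}

/-! ### Arithmetic of one stage -/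

/-- Shift bookkeeping of one stage: `N · 25⁵ (3 x + 3) ≤ 3 (2²⁵ N) x` for `x ≥ 1`
(`2 · 25⁵ = 19531250 ≤ 2²⁵`). [folklore] -/
theorem stage_step_shift (N x : ℕ) (hx : 1 ≤ x) :
    N * (25 ^ 5 * (3 * x + 3)) ≤ 3 * (2 ^ 25 * N * x) := by
  have h1 : 3 * x + 3 ≤ 6 * x := by omega
  calc N * (25 ^ 5 * (3 * x + 3)) ≤ N * (25 ^ 5 * (6 * x)) :=
        Nat.mul_le_mul_left N (Nat.mul_le_mul_left _ h1)
    _ = (6 * 25 ^ 5) * (N * x) := by ring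
    _ ≤ (3 * 2 ^ 25) * (N * x) := Nat.mul_le_mul_right _ (by norm_num)
    _ = 3 * (2 ^ 25 * N * x) := by ring

/-- Length bookkeeping of one stage: `N (9⁵ (x B + 20) + 1) + 1 ≤ (2²⁵ N) x B` for `N, x ≥ 1`,
`B ≥ 21`. [folklore] -/
theorem stage_step_length (N x B : ℕ) (hN : 1 ≤ N) (hx : 1 ≤ x) (hB : 21 ≤ B) :
    N * (9 ^ 5 * (x * B + 20) + 1) + 1 ≤ 2 ^ 25 * N * x * B := by
  have h95 : (9 : ℕ) ^ 5 = 59049 := by norm_num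
  have h225 : (2 : ℕ) ^ 25 = 33554432 := by norm_num
  rw [h95, h225]
  set y := x * B with hy
  have hy21 : 21 ≤ y := by rw [hy]; nlinarith
  have hNy : 1 ≤ N * y := Nat.one_le_iff_ne_zero.2 (Nat.mul_ne_zero (by omega) (by omega))
  have h2 : 59049 * (y + 20) + 1 + y ≤ 33554432 * y := by omega
  calc N * (59049 * (y + 20) + 1) + 1 ≤ N * (59049 * (y + 20) + 1) + N * y :=
        Nat.add_le_add_left hNy _
    _ = N * (59049 * (y + 20) + 1 + y) := by ring
    _ ≤ N * (33554432 * y) := Nat.mul_le_mul_left N h2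
    _ = 33554432 * N * x * B := by rw [hy]; ring

/-! ### The stage recursion with integral border Q-words -/

section Stage

variable {σ : Type} {ι : Type*} [Fintype ι] [DecidableEq ι] (H : HomCircuit ℂ σ ι)

/-- **The stage recursion** (BCS 1997, proof of Thm. (21.36), (F)–(H); BIZ18 Thm 3.1): given the
four gadgets, every atom of formal degree `≤ 2^j` of a homogeneous circuit certificate on `ι`
over a finite variable set `σ` has an integral border Q-word at precision `3` with shift
`≤ 3 K^j` and length `≤ K^j (8 #σ + 29)`, where `K = 2^25 #ι²`. Stage `j + 1`: an atom of
formal degree `≥ 2` is the sum of `≤ #ι²` products of `≤ 5` atoms of formal degree `≤ 2^j`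
(`expandAtom_sum`, `expandAtom_half`, `expandAtom_length_le`, `length_expandAtom_le`); atoms of
formal degree `≤ 1` are affine (`totalDegree_aval_le`). [cite: BringmannIkenmeyerZuiddam2018, Thm 3.1 with Prop. 3.5; stage recursion: BurgisserClausenShokrollahi1997, Thm. (21.36)] -/
theorem ibq_aval [Fintype σ] : ADD[σ] → SMUL[σ] → CUBE[σ] → SQ[σ] →
    ∀ (j : ℕ) (a : HomCircuit.Atom ι), H.adeg a ≤ 2 ^ j →
      IBQ[σ | H.aval a, 3 * (2 ^ 25 * (Fintype.card ι * Fintype.card ι)) ^ j, 3,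
        (2 ^ 25 * (Fintype.card ι * Fintype.card ι)) ^ j * (8 * Fintype.card σ + 29)] := by
  intro hadd hsmul hcube hsq j
  induction j with
  | zero =>
    intro a ha
    have haff := ibq_of_totalDegree_le_one hadd hsmul
      ((H.totalDegree_aval_le a).trans (by simpa using ha)) 3
    refine ibq_mono haff (Nat.zero_le _) ?_
    rw [pow_zero, one_mul]
    omega
  | succ j ih =>
    intro a ha
    set N := Fintype.card ι * Fintype.card ι with hN
    set K := 2 ^ 25 * N with hK
    set B := 8 * Fintype.card σ + 29 with hB
    have hN1 : 1 ≤ N := by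
      have hne : Nonempty ι := by
        cases a with
        | node ν => exact ⟨ν⟩
        | quot ν μ => exact ⟨ν⟩
      have := Fintype.card_pos_iff.2 hne
      exact Nat.one_le_iff_ne_zero.2 (Nat.mul_ne_zero (by omega) (by omega))
    have hK1 : 1 ≤ K := by rw [hK]; omega
    have hKj : 1 ≤ K ^ j := Nat.one_le_pow _ _ hK1
    have hB21 : 21 ≤ B := by omega
    by_cases h2 : 2 ≤ H.adeg a
    · -- expand: sum of ≤ N products of ≤ 5 atoms of formal degree ≤ 2^j
      rw [← H.expandAtom_sum h2]
      have hterm : ∀ p ∈ (H.expandAtom a).map H.tval,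
          IBQ[σ | p, 25 ^ 5 * (3 * K ^ j + 3), 3, 9 ^ 5 * (K ^ j * B + 20)] := by
        intro p hp
        obtain ⟨T, hT, rfl⟩ := List.mem_map.1 hp
        have hfac : ∀ q ∈ T.map H.aval, IBQ[σ | q, 3 * K ^ j, 3, K ^ j * B] := by
          intro q hq
          obtain ⟨b, hb, rfl⟩ := List.mem_map.1 hq
          refine ih b ?_
          have := H.expandAtom_half hT b hb
          rw [pow_succ] at ha
          omega
        have hprod := ibq_list_prod hadd hsmul hcube hsq hfac
        rw [List.length_map] at hprod
        have hT5 := H.expandAtom_length_le hT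
        refine ibq_mono hprod ?_ ?_
        · exact Nat.mul_le_mul_right _ (Nat.pow_le_pow_right (by norm_num) hT5)
        · exact Nat.mul_le_mul_right _ (Nat.pow_le_pow_right (by norm_num) hT5)
      have hsum := ibq_list_sum hadd hterm
      rw [List.length_map] at hsum
      have hlen := H.length_expandAtom_le a
      refine ibq_mono hsum ?_ ?_
      · calc (H.expandAtom a).length * (25 ^ 5 * (3 * K ^ j + 3))
            ≤ N * (25 ^ 5 * (3 * K ^ j + 3)) := Nat.mul_le_mul_right _ hlen
          _ ≤ 3 * (2 ^ 25 * N * K ^ j) := stage_step_shift N (K ^ j) hKj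
          _ = 3 * K ^ (j + 1) := by rw [hK, pow_succ]; ring
      · calc (H.expandAtom a).length * (9 ^ 5 * (K ^ j * B + 20) + 1) + 1
            ≤ N * (9 ^ 5 * (K ^ j * B + 20) + 1) + 1 :=
              Nat.add_le_add_right (Nat.mul_le_mul_right _ hlen) 1
          _ ≤ 2 ^ 25 * N * K ^ j * B := stage_step_length N (K ^ j) B hN1 hKj hB21
          _ = K ^ (j + 1) * B := by rw [hK, pow_succ]; ring
    · -- affine atom
      have haff := ibq_of_totalDegree_le_one hadd hsmul
        ((H.totalDegree_aval_le a).trans (by omega)) 3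
      refine ibq_mono haff (Nat.zero_le _) ?_
      have hKj1 : 1 ≤ K ^ (j + 1) := Nat.one_le_pow _ _ hK1
      nlinarith

end Stage

/-! ### Values of straight-line programs -/

/-- **Values of straight-line programs** (BCS 1997, Lemma (21.25) with Thm. (21.36); BIZ18
Thm 3.1 at qp scale): given the four gadgets, a line value of total degree `≤ d` of a
straight-line program `S` over a finite variable set is the sum of its homogeneous components of
degrees `0, …, d`, node values of `S.homogenize d` (`≤ 4 · len · (d+1)²` nodes) of formal degree
`≤ d < 2^(log₂ d + 1)`; hence it has an integral border Q-word at precision `3` with shift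
`≤ (d + 1) · 3 K^J` and length `≤ (d + 1) (K^J (8 #σ + 29) + 1) + 1`, `J = log₂ d + 1`,
`K = 2^25 (4 len (d+1)²)²`. [cite: BringmannIkenmeyerZuiddam2018, Thm 3.1; BurgisserClausenShokrollahi1997, Lemma (21.25) and Thm. (21.36)] -/
theorem ibq_val {σ : Type} [Fintype σ] : ADD[σ] → SMUL[σ] → CUBE[σ] → SQ[σ] →
    ∀ (S : SLP ℂ σ) (d : ℕ) {i : ℕ}, i < S.len → (S.val i).totalDegree ≤ d →
    IBQ[σ | S.val i,
      (d + 1) * (3 * (2 ^ 25 * ((4 * S.len * (d + 1) ^ 2) * (4 * S.len * (d + 1) ^ 2))) ^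
        (Nat.log 2 d + 1)), 3,
      (d + 1) * ((2 ^ 25 * ((4 * S.len * (d + 1) ^ 2) * (4 * S.len * (d + 1) ^ 2))) ^
        (Nat.log 2 d + 1) * (8 * Fintype.card σ + 29) + 1) + 1] := by
  intro hadd hsmul hcube hsq S d i hi hd
  classical
  rw [← sum_homogeneousComponent_of_le hd]
  set K := 2 ^ 25 * ((4 * S.len * (d + 1) ^ 2) * (4 * S.len * (d + 1) ^ 2)) with hK
  have hcomp : ∀ e ∈ Finset.range (d + 1),
      IBQ[σ | homogeneousComponent e (S.val i), 3 * K ^ (Nat.log 2 d + 1), 3,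
        K ^ (Nat.log 2 d + 1) * (8 * Fintype.card σ + 29)] := by
    intro e he
    have he' : e < d + 1 := Finset.mem_range.1 he
    have hval : (S.homogenize d).aval (.node (⟨i, hi⟩, SLP.Tag.Q ⟨e, he'⟩)) =
        homogeneousComponent e (S.val i) := rfl
    rw [← hval]
    have hKle : 2 ^ 25 * (Fintype.card (S.Node d) * Fintype.card (S.Node d)) ≤ K :=
      Nat.mul_le_mul_left _ (Nat.mul_le_mul (S.card_node_le d) (S.card_node_le d))
    refine ibq_mono (ibq_aval (S.homogenize d) hadd hsmul hcube hsq (Nat.log 2 d + 1) _ ?_)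
      ?_ ?_
    · show e ≤ 2 ^ (Nat.log 2 d + 1)
      exact (Nat.lt_succ_iff.1 he').trans (Nat.lt_pow_succ_log_self Nat.one_lt_two d).le
    · exact Nat.mul_le_mul_left 3 (Nat.pow_le_pow_left hKle _)
    · exact Nat.mul_le_mul_right _ (Nat.pow_le_pow_left hKle _)
  have := ibq_finset_sum hadd (Finset.range (d + 1)) hcomp
  rwa [Finset.card_range] at this

/-! ### The quasi-polynomial arithmetic -/

/-- `K^J ≤ 2^((6E+29)E)` for `K = 2^25 (4 L (d+1)²)²`, `J = log₂ d + 1`, when `L ≤ 2^E`,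
`d < 2^E`, `1 ≤ E`. [folklore] -/
theorem stage_pow_bound {d L E : ℕ} (hd : d < 2 ^ E) (hL : L ≤ 2 ^ E) (hE : 1 ≤ E) :
    (2 ^ 25 * ((4 * L * (d + 1) ^ 2) * (4 * L * (d + 1) ^ 2))) ^ (Nat.log 2 d + 1) ≤
      2 ^ ((6 * E + 29) * E) := by
  have hd1 : d + 1 ≤ 2 ^ E := hd
  have hS : 4 * L * (d + 1) ^ 2 ≤ 2 ^ (3 * E + 2) := by
    calc 4 * L * (d + 1) ^ 2 ≤ 4 * 2 ^ E * (2 ^ E) ^ 2 :=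
          Nat.mul_le_mul (Nat.mul_le_mul_left 4 hL) (Nat.pow_le_pow_left hd1 2)
      _ = 2 ^ (3 * E + 2) := by rw [← pow_mul, pow_add, pow_mul]; ring
  have hSS : (4 * L * (d + 1) ^ 2) * (4 * L * (d + 1) ^ 2) ≤ 2 ^ (6 * E + 4) := by
    calc (4 * L * (d + 1) ^ 2) * (4 * L * (d + 1) ^ 2) ≤ 2 ^ (3 * E + 2) * 2 ^ (3 * E + 2) :=
          Nat.mul_le_mul hS hS
      _ = 2 ^ (6 * E + 4) := by rw [← pow_add]; ring_nf
  have hK : 2 ^ 25 * ((4 * L * (d + 1) ^ 2) * (4 * L * (d + 1) ^ 2)) ≤ 2 ^ (6 * E + 29) := by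
    calc 2 ^ 25 * ((4 * L * (d + 1) ^ 2) * (4 * L * (d + 1) ^ 2)) ≤ 2 ^ 25 * 2 ^ (6 * E + 4) :=
          Nat.mul_le_mul_left _ hSS
      _ = 2 ^ (6 * E + 29) := by rw [← pow_add]; ring_nf
  have hlog : Nat.log 2 d + 1 ≤ E := by
    rcases Nat.eq_zero_or_pos d with rfl | hdpos
    · simpa using hE
    · exact Nat.succ_le_of_lt ((Nat.log_lt_iff_lt_pow Nat.one_lt_two hdpos.ne').2 hd)
  calc (2 ^ 25 * ((4 * L * (d + 1) ^ 2) * (4 * L * (d + 1) ^ 2))) ^ (Nat.log 2 d + 1)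
      ≤ (2 ^ (6 * E + 29)) ^ (Nat.log 2 d + 1) := Nat.pow_le_pow_left hK _
    _ ≤ (2 ^ (6 * E + 29)) ^ E := Nat.pow_le_pow_right (Nat.two_pow_pos _) hlog
    _ = 2 ^ ((6 * E + 29) * E) := by rw [← pow_mul]

/-- The shift bound: `(d + 1) · 3 K^J ≤ 2^(100 E²)`. [folklore] -/
theorem stage_shift_bound {d L E : ℕ} (hd : d < 2 ^ E) (hL : L ≤ 2 ^ E) (hE : 1 ≤ E) :
    (d + 1) * (3 * (2 ^ 25 * ((4 * L * (d + 1) ^ 2) * (4 * L * (d + 1) ^ 2))) ^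
      (Nat.log 2 d + 1)) ≤ 2 ^ (100 * E ^ 2) := by
  have hd1 : d + 1 ≤ 2 ^ E := hd
  have hpow := stage_pow_bound hd hL hE
  calc (d + 1) * (3 * (2 ^ 25 * ((4 * L * (d + 1) ^ 2) * (4 * L * (d + 1) ^ 2))) ^
        (Nat.log 2 d + 1))
      ≤ 2 ^ E * (2 ^ 2 * 2 ^ ((6 * E + 29) * E)) :=
        Nat.mul_le_mul hd1 (Nat.mul_le_mul (by norm_num) hpow)
    _ = 2 ^ (E + 2 + (6 * E + 29) * E) := by rw [← pow_add, ← pow_add]; ring_nf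
    _ ≤ 2 ^ (100 * E ^ 2) := Nat.pow_le_pow_right (by norm_num) (by nlinarith)

/-- The length bound: `(d + 1) (K^J (8 n + 29) + 1) + 1 ≤ 2^(100 E²)` when `n ≤ 2^E`. [folklore] -/
theorem stage_length_bound {d L n E : ℕ} (hd : d < 2 ^ E) (hL : L ≤ 2 ^ E) (hn : n ≤ 2 ^ E)
    (hE : 1 ≤ E) :
    (d + 1) * ((2 ^ 25 * ((4 * L * (d + 1) ^ 2) * (4 * L * (d + 1) ^ 2))) ^
      (Nat.log 2 d + 1) * (8 * n + 29) + 1) + 1 ≤ 2 ^ (100 * E ^ 2) := by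
  have hd1 : d + 1 ≤ 2 ^ E := hd
  have hpow := stage_pow_bound hd hL hE
  have h2E : 2 ≤ 2 ^ E := by
    calc 2 = 2 ^ 1 := by norm_num
      _ ≤ 2 ^ E := Nat.pow_le_pow_right (by norm_num) hE
  have hB : 8 * n + 29 ≤ 2 ^ (E + 6) := by
    have : 2 ^ (E + 6) = 2 ^ E * 64 := by rw [pow_add]; norm_num
    rw [this]
    omega
  set P := (2 ^ 25 * ((4 * L * (d + 1) ^ 2) * (4 * L * (d + 1) ^ 2))) ^ (Nat.log 2 d + 1)
    with hP
  have hP1 : 1 ≤ 2 ^ ((6 * E + 29) * E) := Nat.one_le_two_pow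
  have h1 : P * (8 * n + 29) + 1 ≤ 2 ^ ((6 * E + 29) * E + (E + 6) + 1) := by
    have hmul : P * (8 * n + 29) ≤ 2 ^ ((6 * E + 29) * E + (E + 6)) := by
      rw [pow_add]; exact Nat.mul_le_mul hpow hB
    have h1' : 1 ≤ 2 ^ ((6 * E + 29) * E + (E + 6)) := Nat.one_le_two_pow
    rw [pow_succ]
    omega
  have h2 : (d + 1) * (P * (8 * n + 29) + 1) ≤ 2 ^ (E + ((6 * E + 29) * E + (E + 6) + 1)) := by
    rw [pow_add 2 E]
    exact Nat.mul_le_mul hd1 h1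
  have h3 : (d + 1) * (P * (8 * n + 29) + 1) + 1 ≤
      2 ^ (E + ((6 * E + 29) * E + (E + 6) + 1) + 1) := by
    have h1' : 1 ≤ 2 ^ (E + ((6 * E + 29) * E + (E + 6) + 1)) := Nat.one_le_two_pow
    rw [pow_succ]
    omega
  refine h3.trans (Nat.pow_le_pow_right (by norm_num) ?_)
  nlinarith

/-! ### The packaged statement (= stub `stub_stage` of the crux skeleton) -/

/-- **Straight-line programs have quasi-polynomial integral border Q-words** (BIZ18 Thm 3.1 at
quasi-polynomial scale, through the VSBR stage recursion instead of Brent-balanced formulas):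
GIVEN the four gadgets, every line value of total degree `≤ d` of a straight-line program of
length `≤ 2^E` over `≤ 2^E` variables, `d < 2^E`, `1 ≤ E`, has an integral border Q-word of shift
and length `≤ 2^(100 E²)` and precision `1`.
[cite: BringmannIkenmeyerZuiddam2018, Thm 3.1 and Prop. 3.6 (here via circuits)] -/
theorem exists_ibq_val_qp :
    (∀ {σ : Type}, ADD[σ]) → (∀ {σ : Type}, SMUL[σ]) → (∀ {σ : Type}, CUBE[σ]) →
    (∀ {σ : Type}, SQ[σ]) →
      ∀ {σ : Type} [Fintype σ] (S : SLP ℂ σ) (d E i : ℕ),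
        1 ≤ E → S.len ≤ 2 ^ E → d < 2 ^ E → Fintype.card σ ≤ 2 ^ E → i < S.len →
        (S.val i).totalDegree ≤ d →
        IBQ[σ | S.val i, 2 ^ (100 * E ^ 2), 1, 2 ^ (100 * E ^ 2)] := by
  intro hadd hsmul hcube hsq σ _ S d E i hE hlen hd hcard hi hdeg
  have h := ibq_val (hadd (σ := σ)) (hsmul (σ := σ)) (hcube (σ := σ)) (hsq (σ := σ)) S d hi hdeg
  have h1 := ibq_prec h (show 1 ≤ 3 by norm_num)
  exact ibq_mono h1 (stage_shift_bound hd hlen hE) (stage_length_bound hd hlen hcard hE)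

end BorderQWord

end Literature.Computability.AlgebraicComplexity
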